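import Literature.NumberTheory.EllipticCurves.FormalLogValuesIntegralCoeff
import Literature.NumberTheory.EllipticCurves.FormalGroupLimitLogSeries
import HarnessLib

/-!
# The series `log_W` of a Weierstrass equation over a coefficient ring `A` acting on `𝒪_K` IS the limit logarithm of `E = W ⊗ K` on the level
# `E⁽ᵖ⁾(K)`: `Σ [Xⁿ]log_W · z(Q)ⁿ = ℓ_p(Q) = log_ω(Q)` (`‖z(Q)‖ ≤ ‖p‖`), for every complete ultrametric `K` with `‖p‖ < 1`

Topic `Literature/NumberTheory/EllipticCurves`; namespace `Literature.NumberTheory.EllipticCurves`. THEOREMS ONLY (no definition, no named fact, no instance,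
no `sorry`). This is `FormalGroupLimitLogSeries` §5 (`tsum_coeff_formalLog_zCoord_eq_limitLog`, `hasSum_coeff_succ_formalLog_zCoord_padicLogPointFiniteExt`, stated
there for `W/ℤ`) for a Weierstrass equation `W` over ANY discrete coefficient ring `A` with `[Algebra A (unitBall K)]` (e.g. the ramified `𝒪_D = ℤ_p[ϖ]`):
the additivity input is `FormalLogValuesIntegralCoeff.tsum_coeff_formalLog_map_evF` (J4b) and the tail estimate is re-derived from the log-type bound.

* §1 `curveOver_eq_map_subtype_comp` — `curveOver K W = W.map (𝒪_K.subtype ∘ algebraMap A 𝒪_K)` (so the series of J4b is `(curveOver K W).formalLog`);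
  `norm_coeff_formalLog_curveOver_le_inv_norm` (`‖[Xⁿ]log‖ ≤ ‖n‖⁻¹`), `summable_coeff_formalLog_curveOver_mul_pow`,
  `norm_tsum_coeff_formalLog_curveOver_mul_pow_sub_le` — the tail estimate **`‖log_E(z) − z‖ ≤ ‖z‖²/‖p‖`** for `‖z‖ ≤ ‖p‖`.
* §2 `tsum_coeff_formalLog_curveOver_zCoord_add` (additivity on `E₁(K)`), ★★ `tsum_coeff_formalLog_curveOver_zCoord_eq_limitLog` (**`Σ [Xⁿ]log·z(Q)ⁿ = ℓ_p(Q)`** on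
  `E⁽ᵖ⁾(K)`), ★★ `tsum_coeff_formalLog_curveOver_zCoord_eq_padicLogPointFiniteExt` (**`= log_ω(Q)`**), and the formal-point form
  `tsum_coeff_formalLog_map_eq_padicLogPointFiniteExt_ptOfZ` (**`Σ [Xⁿ]log_W·tⁿ = log_ω(P(t))`** for `‖t‖ ≤ ‖p‖`, in J4b's coefficient form).

Purpose (crux K★ `stmt-BirchSwinnertonDyer-22226`, line `kato_lever`, memo `Lines/kato-lever-K2-ramified-cm-transport.md` §10.1, `hθb`): the θ-value
`p^e·Σ'[Xʲ]log_{W_D}·u₀ʲ` of the integrating element of the transported Hodge pair (T2c) is `p^e·log_ω(P)` for the rational point `P = P(u₀)` of the ramified good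
model `W_D ⊗ ℂ_F` (after a `[p]`-power push into the level, as in `BdRPlusFormalLogTheta` §4). Infrastructure only; BSD / K★ are not proved by any of this.

## References
* J. H. Silverman, *The Arithmetic of Elliptic Curves* (2009), IV.5.5, IV.6.3, Thm. IV.6.4, Prop. VII.2.2. [SilvermanAEC2009]
* J.-P. Serre, *Local class field theory*, in Cassels–Fröhlich (1967), Ch. VI §3.2. [CasselsFrohlichANT1967]
-/

noncomputable section

open scoped Classical NNReal Topology
open PowerSeries Filter Finset

namespace Literature.NumberTheory.EllipticCurves

open Literature.NumberTheory.GaloisRepresentations.LubinTate Literature.NumberTheory.PAdicHodge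
open Literature.NumberTheory.EllipticCurves.FormalGroupChart _root_.WeierstrassCurve

variable {K : Type*} [NontriviallyNormedField K] [IsUltrametricDist K] [CompleteSpace K] [CharZero K]
  {A : Type*} [CommRing A] [UniformSpace A] [DiscreteUniformity A] [Algebra A (unitBall K)] [ContinuousSMul A (unitBall K)]
  {p : ℕ} [hp : Fact p.Prime]

/-! ## §1 The series, its coefficients, the tail estimate -/

omit [CompleteSpace K] [CharZero K] [UniformSpace A] [DiscreteUniformity A] [ContinuousSMul A (unitBall K)] hp in
/-- `curveOver K W = W ⊗_φ K` with `φ = 𝒪_K.subtype ∘ algebraMap A 𝒪_K` (so `(curveOver K W).formalLog` is the series of `FormalLogValuesIntegralCoeff`).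
[cite: SilvermanAEC2009, VII.§1] -/
theorem curveOver_eq_map_subtype_comp (W : WeierstrassCurve A) : curveOver K W = W.map ((unitBall K).subtype.comp (algebraMap A (unitBall K))) := by
  rw [curveOver, ballIntModel, WeierstrassCurve.baseChange, WeierstrassCurve.map_map]
  rfl

omit [CompleteSpace K] [UniformSpace A] [DiscreteUniformity A] [ContinuousSMul A (unitBall K)] hp in
/-- **`‖[Xⁿ]log_E‖ ≤ ‖n‖⁻¹`** for `n ≥ 1` (`log_E` is log-type: `‖n·[Xⁿ]log_E‖ ≤ 1`, tree `norm_natCast_mul_coeff_formalLog_map_le_one'`).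
[cite: SilvermanAEC2009, IV.5.5] -/
theorem norm_coeff_formalLog_curveOver_le_inv_norm (W : WeierstrassCurve A) {n : ℕ} (hn : n ≠ 0) :
    ‖coeff n (curveOver K W).formalLog‖ ≤ ‖(n : K)‖⁻¹ := by
  have hn0 : (n : K) ≠ 0 := Nat.cast_ne_zero.2 hn
  have h1 := norm_natCast_mul_coeff_formalLog_map_le_one' ((unitBall K).subtype.comp (algebraMap A (unitBall K)))
    norm_subtype_comp_algebraMap_le_one W n
  rw [← curveOver_eq_map_subtype_comp, norm_mul] at h1
  rw [← one_div, le_div_iff₀ (norm_pos_iff.2 hn0), mul_comm]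
  exact h1

omit [UniformSpace A] [DiscreteUniformity A] [ContinuousSMul A (unitBall K)] in
/-- Summability of `Σ [Xⁿ]log_E · zⁿ` for `‖z‖ < 1` (`‖[Xⁿ]log_E‖ ≤ n^k`). [cite: SilvermanAEC2009, Thm. IV.6.4] -/
theorem summable_coeff_formalLog_curveOver_mul_pow (W : WeierstrassCurve A) (hp1 : ‖(p : K)‖ < 1) {z : K} (hz : ‖z‖ < 1) :
    Summable fun n : ℕ => coeff n (curveOver K W).formalLog * z ^ n := by
  obtain ⟨k, hk⟩ := exists_nat_norm_coeff_formalLog_map_le_pow_of_algebra (K := K) W hp1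
  rw [curveOver_eq_map_subtype_comp]
  exact summable_coeff_mul_pow_of_norm_coeff_le_pow _ k hk hz

omit [IsUltrametricDist K] [CompleteSpace K] [CharZero K] hp in
/-- In an ultrametric group, a `HasSum` all of whose terms have norm `≤ C` has norm `≤ C`. [folklore] -/
private theorem norm_le_of_hasSum_of_forall_norm_le_chart {G : Type*} [SeminormedAddCommGroup G] [IsUltrametricDist G] {ι : Type*}
    {f : ι → G} {a : G} (ha : HasSum f a) {C : ℝ} (hC : 0 ≤ C) (h : ∀ i, ‖f i‖ ≤ C) : ‖a‖ ≤ C :=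
  (isClosed_le continuous_norm continuous_const).mem_of_tendsto ha
    (Eventually.of_forall fun _ => IsUltrametricDist.norm_sum_le_of_forall_le_of_nonneg hC fun i _ => h i)

omit [UniformSpace A] [DiscreteUniformity A] [ContinuousSMul A (unitBall K)] in
/-- ★ **Tail estimate: `‖log_E(z) − z‖ ≤ ‖z‖²/‖p‖` for `‖z‖ ≤ ‖p‖`** (`‖[Xⁿ]log·zⁿ‖ ≤ ‖z‖ⁿ/‖p‖^{n−1} ≤ ‖z‖²/‖p‖` for `n ≥ 2`, using `‖p‖^{n−1} ≤ ‖n‖`).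
[cite: SilvermanAEC2009, IV.6.3] -/
theorem norm_tsum_coeff_formalLog_curveOver_mul_pow_sub_le (W : WeierstrassCurve A) (hp0 : (p : K) ≠ 0) (hp1 : ‖(p : K)‖ < 1) {z : K} (hz : ‖z‖ ≤ ‖(p : K)‖) :
    ‖∑' n : ℕ, coeff n (curveOver K W).formalLog * z ^ n - z‖ ≤ ‖z‖ ^ 2 / ‖(p : K)‖ := by
  have hp' : 0 < ‖(p : K)‖ := norm_pos_iff.mpr hp0
  have hz1 : ‖z‖ < 1 := hz.trans_lt hp1
  have hsum := summable_coeff_formalLog_curveOver_mul_pow W hp1 hz1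
  have hsplit : ∑' n : ℕ, coeff n (curveOver K W).formalLog * z ^ n =
      z + ∑' n : ℕ, coeff (n + 2) (curveOver K W).formalLog * z ^ (n + 2) := by
    rw [← hsum.sum_add_tsum_nat_add 2, sum_range_succ, sum_range_one, coeff_zero_eq_constantCoeff_apply, constantCoeff_formalLog,
      coeff_one_formalLog]
    ring
  rw [hsplit, add_sub_cancel_left]
  have htail : HasSum (fun n : ℕ => coeff (n + 2) (curveOver K W).formalLog * z ^ (n + 2))
      (∑' n : ℕ, coeff (n + 2) (curveOver K W).formalLog * z ^ (n + 2)) := ((summable_nat_add_iff 2).mpr hsum).hasSum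
  refine norm_le_of_hasSum_of_forall_norm_le_chart htail (by positivity) fun n => ?_
  have hc : ‖coeff (n + 2) (curveOver K W).formalLog‖ ≤ (‖(p : K)‖ ^ (n + 1))⁻¹ := by
    refine (norm_coeff_formalLog_curveOver_le_inv_norm W (Nat.succ_ne_zero (n + 1))).trans ?_
    refine inv_anti₀ (pow_pos hp' _) ?_
    have h := norm_pow_le_norm_natCast_succ (K := K) hp1 (n + 1)
    exact h
  rw [norm_mul, norm_pow]
  calc ‖coeff (n + 2) (curveOver K W).formalLog‖ * ‖z‖ ^ (n + 2)
      ≤ (‖(p : K)‖ ^ (n + 1))⁻¹ * ‖z‖ ^ (n + 2) := mul_le_mul_of_nonneg_right hc (pow_nonneg (norm_nonneg _) _)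
    _ = ‖z‖ ^ 2 / ‖(p : K)‖ * (‖z‖ / ‖(p : K)‖) ^ n := by
        rw [div_pow]; field_simp; ring
    _ ≤ ‖z‖ ^ 2 / ‖(p : K)‖ * 1 := by
        refine mul_le_mul_of_nonneg_left (pow_le_one₀ (by positivity) ((div_le_one hp').mpr hz)) (by positivity)
    _ = ‖z‖ ^ 2 / ‖(p : K)‖ := mul_one _

/-! ## §2 Additivity on `E₁(K)` and the identification with the limit logarithm -/

/-- ★ **`log_E(z(P + Q)) = log_E(z(P)) + log_E(z(Q))` on `E₁(K)`** for `W` over any coefficient ring `A` (tree `zCoord_add` + J4b's value additivity).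
[cite: SilvermanAEC2009, Thm. IV.6.4 with Prop. VII.2.2] -/
theorem tsum_coeff_formalLog_curveOver_zCoord_add (W : WeierstrassCurve A) [(curveOver K W).IsElliptic] (hp1 : ‖(p : K)‖ < 1) {P Q : (curveOver K W).toAffine.Point}
    (hP : P ∈ kernel (NormedField.valuation (K := K)) (curveOver K W)) (hQ : Q ∈ kernel (NormedField.valuation (K := K)) (curveOver K W)) :
    ∑' n : ℕ, coeff n (curveOver K W).formalLog * (P + Q).zCoord ^ n =
      ∑' n : ℕ, coeff n (curveOver K W).formalLog * P.zCoord ^ n + ∑' n : ℕ, coeff n (curveOver K W).formalLog * Q.zCoord ^ n := by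
  have h := tsum_coeff_formalLog_map_evF (K := K) W hp1 (zPt P hP) (zPt Q hQ)
  rw [← curveOver_eq_map_subtype_comp] at h
  rw [zCoord_add hP hQ]
  exact h

omit [IsUltrametricDist K] [CompleteSpace K] in
/-- `p ≠ 0` in `K`. [folklore] -/
private theorem natCast_p_ne_zero' : (p : K) ≠ 0 := Nat.cast_ne_zero.2 hp.out.ne_zero

omit [CompleteSpace K] [CharZero K] hp in
/-- `‖p‖ < 1` in the valuation currency of the chart files. [folklore] -/
private theorem valuation_p_lt_one' (hp1 : ‖(p : K)‖ < 1) : NormedField.valuation (p : K) < 1 := by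
  rw [← NNReal.coe_lt_coe, NormedField.valuation_apply, coe_nnnorm]; exact hp1

/-- ★★ **`Σ [Xⁿ]log_E · z(Q)ⁿ = ℓ_p(Q)` for `Q ∈ E⁽ᵖ⁾(K)`** (`‖z(Q)‖ ≤ ‖p‖`), `W` over any coefficient ring `A` acting on `𝒪_K`: the series is THE limit logarithm
(characterisation `spec_of_additive_of_val_sub_zCoord_le` from §2 additivity and §1 tail estimate). [cite: SilvermanAEC2009, Thm. IV.6.4 with Prop. VII.2.2] -/
theorem tsum_coeff_formalLog_curveOver_zCoord_eq_limitLog (W : WeierstrassCurve A) [(curveOver K W).IsElliptic] (hp1 : ‖(p : K)‖ < 1) {Q : (curveOver K W).toAffine.Point}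
    (hQ : Q ∈ level (NormedField.valuation (K := K)) (curveOver K W) (NormedField.valuation (p : K))) :
    ∑' n : ℕ, coeff n (curveOver K W).formalLog * Q.zCoord ^ n = limitLog (NormedField.valuation (K := K)) (curveOver K W) p Q := by
  have hp0 : (p : K) ≠ 0 := natCast_p_ne_zero'
  refine eq_limitLog_of_spec (valuation_p_lt_one' hp1) (ℓ := fun Q => ∑' n : ℕ, coeff n (curveOver K W).formalLog * Q.zCoord ^ n)
    (spec_of_additive_of_val_sub_zCoord_le hp0 (fun P Q hP hQ => tsum_coeff_formalLog_curveOver_zCoord_add W hp1 hP.1 hQ.1) fun Q hQ => ?_) hQ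
  have hz : ‖Q.zCoord‖ ≤ ‖(p : K)‖ := by
    have h := hQ.2
    rwa [← NNReal.coe_le_coe, NormedField.valuation_apply, NormedField.valuation_apply, coe_nnnorm, coe_nnnorm] at h
  have h := norm_tsum_coeff_formalLog_curveOver_mul_pow_sub_le W hp0 hp1 hz
  rw [← NNReal.coe_le_coe, NNReal.coe_div, NNReal.coe_pow, NormedField.valuation_apply, NormedField.valuation_apply,
    NormedField.valuation_apply, coe_nnnorm, coe_nnnorm, coe_nnnorm]
  exact h

/-- ★★ **`Σ [Xⁿ]log_E · z(Q)ⁿ = log_ω(Q)`** (`padicLogPointFiniteExt`) for `Q ∈ E⁽ᵖ⁾(K)`. [cite: SilvermanAEC2009, Thm. IV.6.4 with Prop. VII.2.2] -/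
theorem tsum_coeff_formalLog_curveOver_zCoord_eq_padicLogPointFiniteExt (W : WeierstrassCurve A) [(curveOver K W).IsElliptic] (hp1 : ‖(p : K)‖ < 1)
    {Q : (curveOver K W).toAffine.Point} (hQ : Q ∈ level (NormedField.valuation (K := K)) (curveOver K W) (NormedField.valuation (p : K))) :
    ∑' n : ℕ, coeff n (curveOver K W).formalLog * Q.zCoord ^ n = padicLogPointFiniteExt (NormedField.valuation (K := K)) (curveOver K W) p Q := by
  have hp0 : (p : K) ≠ 0 := natCast_p_ne_zero'
  rw [padicLogPointFiniteExt_eq_limitLog hp0 (valuation_p_lt_one' hp1) (limitLog_spec_of_completeSpace hp0 (valuation_p_lt_one' hp1)) hQ]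
  exact tsum_coeff_formalLog_curveOver_zCoord_eq_limitLog W hp1 hQ

/-- ★★ **Formal points: `Σ [Xⁿ]log_W · tⁿ = log_ω(P(t))`** for `t ∈ 𝔪_K` with `‖t‖ ≤ ‖p‖`, in the coefficient form `(W.map (𝒪_K.subtype ∘ algebraMap A 𝒪_K)).formalLog`
of `FormalLogValuesIntegralCoeff` — the θ-value identification needed by the transported Hodge pair's integrating element (`hθb`) for a RAMIFIED good model.
[cite: SilvermanAEC2009, Thm. IV.6.4 with Prop. VII.2.2] -/
theorem tsum_coeff_formalLog_map_eq_padicLogPointFiniteExt_ptOfZ (W : WeierstrassCurve A) [(curveOver K W).IsElliptic] (hp1 : ‖(p : K)‖ < 1)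
    {t : (ballNilIdeal K).toIdeal} (ht : ‖((t : unitBall K) : K)‖ ≤ ‖(p : K)‖) :
    ∑' n : ℕ, coeff n (W.map ((unitBall K).subtype.comp (algebraMap A (unitBall K)))).formalLog * ((t : unitBall K) : K) ^ n =
      padicLogPointFiniteExt (NormedField.valuation (K := K)) (curveOver K W) p (ptOfZ K W t) := by
  have hlev : ptOfZ K W t ∈ level (NormedField.valuation (K := K)) (curveOver K W) (NormedField.valuation (p : K)) := by
    refine ⟨ptOfZ_mem_kernel t, ?_⟩
    rw [zCoord_ptOfZ, ← NNReal.coe_le_coe, NormedField.valuation_apply, NormedField.valuation_apply, coe_nnnorm, coe_nnnorm]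
    exact ht
  rw [← curveOver_eq_map_subtype_comp, ← tsum_coeff_formalLog_curveOver_zCoord_eq_padicLogPointFiniteExt W hp1 hlev, zCoord_ptOfZ]

end Literature.NumberTheory.EllipticCurves
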